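import Summits.Ventures.Crystal3D.Theorems.StickyWulffConstantTextureLiminfTexShadowGlideEdge
import Summits.Ventures.Crystal3D.Theorems.StickyWulffConstantTextureLiminfTexShadowLevelLedgerEventsStar
import HarnessLib

/-!
# MIRROR LAUNCHES are launch sets of the word automaton: state data, no self-succession, and no straight relaunch
# (lane T, crux `TextureLiminfV5`, stmt-Ventures-23912, registered stub `stub_terraceCensus`; (β) terrace census, LevelReach — count half)

HONEST FRAMING. Venture `Summits/Ventures/Crystal3D` (cell `crystal3d-full`), route `route-Ventures-StickyWulffConstant`, helper `--supports`
the law-v5 crux `TextureLiminfV5` (stmt-Ventures-23912), lane T, mechanism (β) (level ledger in EVENT currency, …TexShadowLevelLedgerEventsStar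
p734592; launch census `word_family_endPairs_launch`, …TexShadowLevelReach p739507).  Pure metric geometry of a twin reading; census-free,
certificate-free; nothing about energies is asserted; F-C1 not moved.

THE POINT.  The level-`k ≥ 2` lines of the (β) ledger are launched at MIRROR BALLS: from a twin reading `r ∈ X` of `(A, n)` and a near slot `w`
(`⟪A w, n⟫ < 0`) the first ball is `q = r + A′ w` in the twin frame `A′ x = A x − 2⟪A x, n⟫ n` (`star_occupied_of_twinReading_mirrorLaunch`).
To feed such balls to the launch census (`hLsrc`, `hLstep` of `word_family_endPairs_launch`, root frame `A′`, root class `w`) one needs, besides the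
moving clause and the invariant (the consumer's): `q ∈ X`, an occupied `A′`-face triple at `q`, the predecessor `q − A′ w = r ∈ X`, and that
`q + A′ w` is not again a launch ball.  This file supplies them, plus the fact that kills the STRAIGHT relaunch case for mirror launches under the
predecessor invariant (…TexShadowLevelReachInvariant): `r − A′ w ∉ X`.  The one metric input is new here:
* `caps_dist_sq` — below a ball, an own lower-cap site and a twinned lower-cap site that are not antipodal images are `1/√3` apart;
* `mirrorLaunch_mem` / `mirrorLaunch_pred_mem` / `mirrorLaunch_face` — `q ∈ X`, `q − A′w ∈ X`, an occupied `A′`-face triple at `q` (the far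
  triple of `(A, n)`, which contains `−w` and lies in the occupied star);
* **`pred_mirrorLaunch_not_mem`** — `r − A′ w ∉ X` (it is `1/√3` from an occupied own lower-cap ball of the reading);
* **`mirrorLaunch_not_twinReading`** — `q = r + A′ w` is NOT a twin reading of `(A, n)` (its own lower cap would be `1/√3` from `r`); hence
  `mirrorLaunch_step_not_mem` — for a set `Rd` of twin readings of `(A, n)` the launch set `{r + A′w : r ∈ Rd}` satisfies `hLstep`.
WHAT THIS IS NOT: the moving clause at `q` (fullness in `A′` depends on the filling — a non-moving `q` is an immediate event of the ledger), any
count or certificate; F-C1 not moved.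
-/

noncomputable section

open scoped InnerProductSpace

namespace Summit.Ventures.Crystal3D.Cruxes.TextureLiminf.TexShadow

open Finset Summit.Ventures.Crystal3D Summit.Ventures.Crystal3D.Theorems

/-! ## The metric core: an own lower-cap site against a twinned lower-cap site -/

/-- **Own versus twinned lower cap.**  `‖n‖ = 1`, slots `v, v'` with `⟪A v, n⟫ = −√(2/3)`, `⟪A v', n⟫ = √(2/3)`, `⟪v, v'⟫ = −½`; then the own
lower-cap site `q + A v` and the twinned site `q + (A v' − 2⟪A v', n⟫ n)` satisfy `dist² = 1/3`. -/
theorem caps_dist_sq (A : EuclideanSpace ℝ (Fin 3) ≃ₗᵢ[ℝ] EuclideanSpace ℝ (Fin 3)) {n v v' : EuclideanSpace ℝ (Fin 3)} (hn : ‖n‖ = 1)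
    (hv : v ∈ fccSlots) (hv' : v' ∈ fccSlots) (hvn : ⟪A v, n⟫_ℝ = -Real.sqrt (2 / 3)) (hv'n : ⟪A v', n⟫_ℝ = Real.sqrt (2 / 3))
    (hvv' : ⟪v, v'⟫_ℝ = -(1 / 2)) (q : EuclideanSpace ℝ (Fin 3)) :
    dist (q + A v) (q + (A v' - (2 * ⟪A v', n⟫_ℝ) • n)) ^ 2 = 1 / 3 := by
  have hvv : ⟪A v, A v⟫_ℝ = 1 := by
    rw [real_inner_self_eq_norm_sq, LinearIsometryEquiv.norm_map, norm_eq_one_of_mem_fccSlots hv, one_pow]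
  have hv'v' : ⟪A v', A v'⟫_ℝ = 1 := by
    rw [real_inner_self_eq_norm_sq, LinearIsometryEquiv.norm_map, norm_eq_one_of_mem_fccSlots hv', one_pow]
  have hnn : ⟪n, n⟫_ℝ = 1 := by rw [real_inner_self_eq_norm_sq, hn, one_pow]
  have h1 : ⟪A v, A v'⟫_ℝ = -(1 / 2) := by rw [LinearIsometryEquiv.inner_map_map, hvv']
  have h2 : ⟪A v', A v⟫_ℝ = -(1 / 2) := by rw [real_inner_comm, h1]
  have hnv : ⟪n, A v⟫_ℝ = -Real.sqrt (2 / 3) := by rw [real_inner_comm, hvn]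
  have hnv' : ⟪n, A v'⟫_ℝ = Real.sqrt (2 / 3) := by rw [real_inner_comm, hv'n]
  have h23 : Real.sqrt (2 / 3) ^ 2 = 2 / 3 := Real.sq_sqrt (by norm_num)
  have e : q + A v - (q + (A v' - (2 * ⟪A v', n⟫_ℝ) • n)) = A v - A v' + (2 * ⟪A v', n⟫_ℝ) • n := by module
  rw [dist_eq_norm, e, ← real_inner_self_eq_norm_sq]
  simp only [inner_add_left, inner_add_right, inner_sub_left, inner_sub_right, real_inner_smul_left, real_inner_smul_right, hvv, hv'v',
    hnn, h1, h2, hvn, hnv, hv'n, hnv']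
  nlinarith [h23]

/-! ## The mirror launch ball: present, predecessor present, an occupied face -/

variable {X : Finset (EuclideanSpace ℝ (Fin 3))} (A A' : EuclideanSpace ℝ (Fin 3) ≃ₗᵢ[ℝ] EuclideanSpace ℝ (Fin 3))
  {n r w : EuclideanSpace ℝ (Fin 3)}

/-- The near slot of a mirror launch has `⟪A w, n⟫ = −√(2/3)` exactly. -/
theorem inner_eq_neg_of_near (hmenu : IsMenuNormal A n) (hw : w ∈ fccSlots) (hwn : ⟪A w, n⟫_ℝ < 0) :
    ⟪A w, n⟫_ℝ = -Real.sqrt (2 / 3) := by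
  have s23 : (0 : ℝ) < Real.sqrt (2 / 3) := Real.sqrt_pos.2 (by norm_num)
  rcases hmenu.2 w hw with h | h | h
  · rw [h] at hwn; exact absurd hwn (lt_irrefl 0)
  · rw [h] at hwn; exact absurd hwn (not_lt.2 s23.le)
  · exact h

/-- **The mirror launch ball is present**: `r + A′ w ∈ X` (it is a mirror ball of the reading). -/
theorem mirrorLaunch_mem (hr : IsTwinReading X A n r) (hw : w ∈ fccSlots) (hwn : ⟪A w, n⟫_ℝ < 0)
    (hA' : ∀ x, A' x = A x - (2 * ⟪A x, n⟫_ℝ) • n) : r + A' w ∈ X := by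
  rw [hA']; exact hr.2.2.1 w hw hwn

/-- **Its predecessor along the launch direction is the reading**: `r + A′ w − A′ w = r ∈ X`. -/
theorem mirrorLaunch_pred_mem (hrX : r ∈ X) : r + A' w - A' w ∈ X := by
  rw [add_sub_cancel_right]; exact hrX

/-- **An occupied `A′`-face triple at the mirror launch ball** (the far triple of `(A, n)`: it contains `−w`, so each of its slots lies in the
occupied closed vertex star of `−w`). -/
theorem mirrorLaunch_face (hrX : r ∈ X) (hr : IsTwinReading X A n r) (hw : w ∈ fccSlots) (hwn : ⟪A w, n⟫_ℝ < 0)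
    (hA' : ∀ x, A' x = A x - (2 * ⟪A x, n⟫_ℝ) • n) :
    ∃ a ∈ fccSlots, ∃ a' ∈ fccSlots, ∃ a'' ∈ fccSlots,
      ⟪a, a'⟫_ℝ = 1 / 2 ∧ ⟪a, a''⟫_ℝ = 1 / 2 ∧ ⟪a', a''⟫_ℝ = 1 / 2 ∧
      r + A' w + A' a ∈ X ∧ r + A' w + A' a' ∈ X ∧ r + A' w + A' a'' ∈ X := by
  have hstar := star_occupied_of_twinReading_mirrorLaunch A A' hrX hr hw hwn hA'
  obtain ⟨hmenu, -, -, -⟩ := hr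
  have s23 : (0 : ℝ) < Real.sqrt (2 / 3) := Real.sqrt_pos.2 (by norm_num)
  obtain ⟨u₁, hu₁, u₂, hu₂, u₃, hu₃, hn₁, hn₂, hn₃, i12, i13, i23, -, huniq⟩ := exists_far_frame A hmenu.1 hmenu.2
  -- `−w` is a far slot, hence one of `u₁, u₂, u₃`; so every `uᵢ` lies in the star of `−w`
  have hwn' := inner_eq_neg_of_near A hmenu hw hwn
  have hneg : 0 < ⟪A (-w), n⟫_ℝ := by rw [map_neg, inner_neg_left, hwn', neg_neg]; exact s23
  have h11 : ⟪u₁, u₁⟫_ℝ = 1 := by rw [real_inner_self_eq_norm_sq, norm_eq_one_of_mem_fccSlots hu₁, one_pow]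
  have h22 : ⟪u₂, u₂⟫_ℝ = 1 := by rw [real_inner_self_eq_norm_sq, norm_eq_one_of_mem_fccSlots hu₂, one_pow]
  have h33 : ⟪u₃, u₃⟫_ℝ = 1 := by rw [real_inner_self_eq_norm_sq, norm_eq_one_of_mem_fccSlots hu₃, one_pow]
  have i21 : ⟪u₂, u₁⟫_ℝ = 1 / 2 := by rw [real_inner_comm]; exact i12
  have i31 : ⟪u₃, u₁⟫_ℝ = 1 / 2 := by rw [real_inner_comm]; exact i13
  have i32 : ⟪u₃, u₂⟫_ℝ = 1 / 2 := by rw [real_inner_comm]; exact i23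
  have hst : 0 < ⟪u₁, -w⟫_ℝ ∧ 0 < ⟪u₂, -w⟫_ℝ ∧ 0 < ⟪u₃, -w⟫_ℝ := by
    rcases huniq (-w) (neg_mem_fccSlots hw) hneg with h | h | h
    · rw [h, h11, i21, i31]; norm_num
    · rw [h, i12, h22, i32]; norm_num
    · rw [h, i13, i23, h33]; norm_num
  exact ⟨u₁, hu₁, u₂, hu₂, u₃, hu₃, i12, i13, i23, hstar u₁ hu₁ hst.1, hstar u₂ hu₂ hst.2.1, hstar u₃ hu₃ hst.2.2⟩

/-! ## No straight relaunch and no self-succession -/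

/-- A near slot `w` of `(A, n)` has a companion near slot `v` with `⟪v, w⟫ = ½` (another slot of the own lower cap). -/
theorem exists_near_adjacent (hmenu : IsMenuNormal A n) (hw : w ∈ fccSlots) (hwn : ⟪A w, n⟫_ℝ < 0) :
    ∃ v ∈ fccSlots, ⟪A v, n⟫_ℝ = -Real.sqrt (2 / 3) ∧ ⟪v, w⟫_ℝ = 1 / 2 := by
  have s23 : (0 : ℝ) < Real.sqrt (2 / 3) := Real.sqrt_pos.2 (by norm_num)
  -- the far frame of `−n` is the lower triple, and `w` is one of its slots
  have hn' : ‖-n‖ = 1 := by rw [norm_neg, hmenu.1]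
  have hmenu' : ∀ v ∈ fccSlots, ⟪A v, -n⟫_ℝ = 0 ∨ ⟪A v, -n⟫_ℝ = Real.sqrt (2 / 3) ∨ ⟪A v, -n⟫_ℝ = -Real.sqrt (2 / 3) := by
    intro v hv
    rw [inner_neg_right]
    rcases hmenu.2 v hv with h0 | h0 | h0
    · exact Or.inl (by rw [h0, neg_zero])
    · exact Or.inr (Or.inr (by rw [h0]))
    · exact Or.inr (Or.inl (by rw [h0, neg_neg]))
  obtain ⟨u₁, hu₁, u₂, hu₂, u₃, hu₃, hn₁, hn₂, hn₃, i12, i13, i23, -, huniq⟩ := exists_far_frame A hn' hmenu'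
  have low : ∀ {v}, ⟪A v, -n⟫_ℝ = Real.sqrt (2 / 3) → ⟪A v, n⟫_ℝ = -Real.sqrt (2 / 3) := by
    intro v hv; rw [inner_neg_right] at hv; linarith
  have hwpos : 0 < ⟪A w, -n⟫_ℝ := by rw [inner_neg_right]; linarith
  have i21 : ⟪u₂, u₁⟫_ℝ = 1 / 2 := by rw [real_inner_comm]; exact i12
  rcases huniq w hw hwpos with rfl | rfl | rfl
  · exact ⟨u₂, hu₂, low hn₂, i21⟩
  · exact ⟨u₁, hu₁, low hn₁, i12⟩
  · exact ⟨u₁, hu₁, low hn₁, i13⟩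

/-- **No straight relaunch into a mirror launch**: the second predecessor `r − A′ w` of the launch ball `r + A′ w` is NOT in `X` — it is a twinned
lower-cap site below the reading `r`, at distance `1/√3` from an occupied own lower-cap ball of `r`.  (Under the predecessor invariant of
…TexShadowLevelReachInvariant the straight relaunch clause of `word_family_endPairs_launch` requires `r − A′ w ∈ X`.) -/
theorem pred_mirrorLaunch_not_mem (hX : ∀ a ∈ X, ∀ b ∈ X, a ≠ b → 1 ≤ dist a b) (hr : IsTwinReading X A n r) (hw : w ∈ fccSlots)
    (hwn : ⟪A w, n⟫_ℝ < 0) (hA' : ∀ x, A' x = A x - (2 * ⟪A x, n⟫_ℝ) • n) : r - A' w ∉ X := by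
  intro hmem
  obtain ⟨hmenu, hown, -, -⟩ := hr
  have s23 : (0 : ℝ) < Real.sqrt (2 / 3) := Real.sqrt_pos.2 (by norm_num)
  have hwn' := inner_eq_neg_of_near A hmenu hw hwn
  obtain ⟨v, hv, hvn, hvw⟩ := exists_near_adjacent A hmenu hw hwn
  -- the occupied own lower-cap ball `r + A v` and the site `r − A′ w = r + (A(−w) − 2⟪A(−w), n⟫ n)`
  have hcap : r + A v ∈ X := hown v hv (by rw [hvn]; linarith)
  have hneg : ⟪A (-w), n⟫_ℝ = Real.sqrt (2 / 3) := by rw [map_neg, inner_neg_left, hwn', neg_neg]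
  have hvw' : ⟪v, -w⟫_ℝ = -(1 / 2) := by rw [inner_neg_right, hvw]
  have hsq := caps_dist_sq A hmenu.1 hv (neg_mem_fccSlots hw) hvn hneg hvw' r
  have e : r - A' w = r + (A (-w) - (2 * ⟪A (-w), n⟫_ℝ) • n) := by
    rw [hA', map_neg, inner_neg_left]; module
  rw [e] at hmem
  set q := r + (A (-w) - (2 * ⟪A (-w), n⟫_ℝ) • n) with hq
  have hne : r + A v ≠ q := by
    intro heq
    rw [heq, dist_self] at hsq
    norm_num at hsq
  have hge := hX _ hcap _ hmem hne
  nlinarith [hge, hsq, dist_nonneg (x := r + A v) (y := q)]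

/-- **A mirror launch ball is not a twin reading of `(A, n)`**: its own lower cap would contain a ball `1/√3` from the reading `r` itself. -/
theorem mirrorLaunch_not_twinReading (hX : ∀ a ∈ X, ∀ b ∈ X, a ≠ b → 1 ≤ dist a b) (hrX : r ∈ X) (hr : IsTwinReading X A n r)
    (hw : w ∈ fccSlots) (hwn : ⟪A w, n⟫_ℝ < 0) (hA' : ∀ x, A' x = A x - (2 * ⟪A x, n⟫_ℝ) • n) :
    ¬ IsTwinReading X A n (r + A' w) := by
  intro hq
  obtain ⟨hmenu, -, -, -⟩ := hr
  obtain ⟨-, hown, -, -⟩ := hq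
  have s23 : (0 : ℝ) < Real.sqrt (2 / 3) := Real.sqrt_pos.2 (by norm_num)
  have hwn' := inner_eq_neg_of_near A hmenu hw hwn
  obtain ⟨v, hv, hvn, hvw⟩ := exists_near_adjacent A hmenu hw hwn
  -- the own lower-cap ball `(r + A′w) + A v` of the would-be reading, against `r = (r + A′w) + (A(−w) − 2⟪A(−w), n⟫ n)`
  have hcap : r + A' w + A v ∈ X := hown v hv (by rw [hvn]; linarith)
  have hneg : ⟪A (-w), n⟫_ℝ = Real.sqrt (2 / 3) := by rw [map_neg, inner_neg_left, hwn', neg_neg]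
  have hvw' : ⟪v, -w⟫_ℝ = -(1 / 2) := by rw [inner_neg_right, hvw]
  have hsq := caps_dist_sq A hmenu.1 hv (neg_mem_fccSlots hw) hvn hneg hvw' (r + A' w)
  have e : r + A' w + (A (-w) - (2 * ⟪A (-w), n⟫_ℝ) • n) = r := by
    rw [hA', map_neg, inner_neg_left]; module
  rw [e] at hsq
  have hne : r + A' w + A v ≠ r := by
    intro heq
    rw [heq, dist_self] at hsq
    norm_num at hsq
  have hge := hX _ hcap _ hrX hne
  nlinarith [hge, hsq, dist_nonneg (x := r + A' w + A v) (y := r)]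

/-- **Mirror launch sets have no self-succession** (`hLstep` of `word_family_endPairs_launch`): for a finite set `Rd ⊆ X` of twin readings of
`(A, n)` and a near slot `w`, no launch ball `p = r + A′ w` has its successor `p + A′ w` again of that form. -/
theorem mirrorLaunch_step_not_mem (hX : ∀ a ∈ X, ∀ b ∈ X, a ≠ b → 1 ≤ dist a b) {Rd : Finset (EuclideanSpace ℝ (Fin 3))}
    (hRd : ∀ r ∈ Rd, r ∈ X ∧ IsTwinReading X A n r) (hw : w ∈ fccSlots) (hwn : ⟪A w, n⟫_ℝ < 0)
    (hA' : ∀ x, A' x = A x - (2 * ⟪A x, n⟫_ℝ) • n) :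
    ∀ p ∈ Rd.image (fun r => r + A' w), p + A' w ∉ Rd.image (fun r => r + A' w) := by
  classical
  intro p hp hmem
  obtain ⟨r, hr, rfl⟩ := mem_image.1 hp
  obtain ⟨r', hr', he⟩ := mem_image.1 hmem
  have he' : r' = r + A' w := add_right_cancel he
  rw [he'] at hr'
  exact mirrorLaunch_not_twinReading A A' hX (hRd r hr).1 (hRd r hr).2 hw hwn hA' (hRd _ hr').2

end Summit.Ventures.Crystal3D.Cruxes.TextureLiminf.TexShadow

end
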